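import Mathlib
import Literature.NumberTheory.EllipticCurves.HeckeOperatorsGamma0Proofs

/-!
# Higher Green functions on `X₀(N) × X₀(N)` and the Gross–Zagier (GKZ) algebraicity conjecture

Named fact (D-0014, sorry-free `def … : Prop`) vendoring the conjecture of Gross–Zagier on the
algebraicity of CM values of rational principal higher Green functions on `X₀(N) × X₀(N)`
(Gross–Zagier 1986, §V.4; raised again in Gross–Kohnen–Zagier 1987, §V.1), in the form printed as
Conjecture 1.1 of Bruinier–Li–Yang, *Deformations of theta integrals and a conjecture of
Gross–Zagier*, Forum Math. Sigma 13 (2025) (arXiv:2204.10604, read pp. 3–5, 10–12), whose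
Theorem 1.4 ends with "In particular Conjecture 1.1 is true" (the case `d₁d₂` not a perfect square
is their Theorem 1.2 combined with Li, arXiv:2106.13653; the case `d₁d₂` a perfect square is
Bruinier–Ehlen–Yang 2021, as recalled on p. 3 of the paper).

Everything the statement needs is defined here with real bodies, following the displayed formulas
(1.1)–(1.3) of Bruinier–Li–Yang 2025 (normalisation of that paper: the sum in (1.1) runs over all of
`Γ₀(N)`, not `Γ₀(N)/{±1}`):

* `greenQ s t = Q_{s-1}(t) = ∫₀^∞ (t + √(t² - 1) cosh u)^{-s} du` ((1.1), Legendre function of the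
  second kind through Heine's integral, integral parameter `s`);
* `heckeMatrices N m = R_N^{(m)} = {(a b; c d) ∈ M₂(ℤ) : N ∣ c, ad - bc = m}` ((1.2): `R_N`, `det = m`);
* `higherGreen N s m z₁ z₂ = G_s^{Γ₀(N), m}(z₁, z₂) = -2 Σ_{γ ∈ R_N^{(m)}} Q_{s-1}(1 + |z₁ - γz₂|²/(2 Im z₁ Im γz₂))`
  — this is (1.2) `Σ_{γ ∈ Γ₀(N) \ R_N, det γ = m} G_s^{Γ₀(N)}(z₁, γ z₂)` with the inner sum (1.1) over
  `Γ₀(N)` unfolded (`Γ₀(N) · R_N^{(m)} = R_N^{(m)}`); `m = 1` is (1.1) itself since `R_N^{(1)} = Γ₀(N)`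
  (`coe_mem_heckeMatrices_one_iff`). Integer matrices act on `ℍ` through Mathlib's `GL(2, ℝ)`-action
  via the tree's `intGL` (`Literature.NumberTheory.EllipticCurves.ModularForms.intGL`). The series
  converges absolutely for `s > 1` (stated for `Re(s) > 1` in (1.1)); as a Lean `tsum` it would be `0`
  if it did not;
* `IsRatWeaklyHolomorphicForm N k f c`: `f ∈ M^{!,∞}_k(Γ₀(N))` (weakly holomorphic of weight `k` for
  `Γ₀(N)`, holomorphic at every cusp other than `∞`, eq. (2.6) of the paper) with Fourier expansion
  `f = Σ_{m ≥ -M} c(m) qᵐ` at `∞` having rational coefficients `c : ℤ → ℚ`;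
* `principalHigherGreen N r c z₁ z₂ = G^{Γ₀(N)}_{r+1,f}(z₁, z₂) = Σ_{m ≥ 1} c(-m) m^r G^{Γ₀(N), m}_{r+1}(z₁, z₂)`
  ((1.3); the printed exponent `m^{k-1}` is `m^r`, `k = r + 1` being the index of `G_k`, cf. the factor
  `r! Σ c(m, μ) m^r Φ_{m,μ}` of (2.12) and Corollary 2.4 of the paper, and Gross–Zagier 1986 §V.4 /
  Viazovska's write-up `G_{k,λ} = Σ λ_m m^{k-1} G_k | T_m`);
* `IsCMPointOfDisc z d`: `z ∈ ℍ` is a root of a primitive integral `a z² + b z + c = 0`, `a > 0`, and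
  `d = b² - 4ac` (the discriminant of a CM point; Gross–Zagier 1985/86, Viazovska 2015 §20.1);
* the divisor `Z_f = Σ_{m ≥ 1, c(-m) ≠ 0} T_m`: `(z₁, z₂) ∈ T_m` iff `z₁ = γ z₂` for some `γ ∈ R_N^{(m)}`
  (proof of Corollary 2.4 of the paper), which is where `G^{Γ₀(N), m}_{r+1}` is singular.

The fact `GKZAlgebraicity` is wanted by route `KontsevichZagierPeriods/TorsionLogsGKZ`
(items stmt-KontsevichZagierPeriods-4040/4041/4454): it makes every Gross–Kohnen–Zagier pair an
unconditional identity. Normalisation remarks: replacing `G` by a non-zero rational multiple, or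
`dⱼ` by the discriminant of another order of `ℚ(zⱼ)` (a rational square multiple), does not change
the truth value of the conclusion `∃ α ∈ ℚ̄ˣ, G = |d₁d₂|^{-r/2} log|α|` (replace `α` by `|α|^q`,
`q ∈ ℚ`).

Mathlib/tree search (2026-08-15): no Legendre functions, no automorphic/higher Green functions, no
weakly holomorphic modular forms (`lean search` for `[Ll]egendreQ`, `higherGreen`, `GreenFunction`,
`weakly holomorphic`: no relevant hits); Mathlib provides `UpperHalfPlane.dist`/`cosh_dist`, the
`GL (Fin 2) ℝ`-action on `ℍ`, `CongruenceSubgroup.Gamma0`, the slash action `f ∣[k] γ` and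
`IsBoundedAtImInfty`, all used below.

What is NOT here: the regularised theta lift `Φ_f^r` on orthogonal Shimura varieties and
Theorem 1.2/1.4 of the paper in that generality (Galois-equivariant `α`, the denominator `κ`, the
factorisation (1.5)); Zhang's height interpretation; any proof.

## References

* J. H. Bruinier, Y. Li, T. Yang, *Deformations of theta integrals and a conjecture of
  Gross–Zagier*, Forum Math. Sigma 13 (2025), doi:10.1017/fms.2024.139, arXiv:2204.10604 —
  Conjecture 1.1, Theorems 1.2 and 1.4, (1.1)–(1.3), (2.6), Corollary 2.4. [`BruinierLiYang2025`]
* B. Gross, D. Zagier, *Heegner points and derivatives of L-series*, Invent. Math. 84 (1986),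
  §II.2 and §V.4. [`GrossZagier1986`]
* B. Gross, W. Kohnen, D. Zagier, *Heegner points and derivatives of L-series. II*, Math. Ann. 278
  (1987), §V.1. [`GrossKohnenZagier1987`]
* Y. Li, *Algebraicity of higher Green functions at a CM point*, arXiv:2106.13653.
* M. Viazovska, *CM values of higher Green's functions and regularized Petersson products*, in
  Arithmetic and Geometry (CUP 2015), §20.1–20.2 (Conjecture 20.3).
-/

noncomputable section

namespace Literature.NumberTheory.Automorphic

open UpperHalfPlane Complex CongruenceSubgroup
open scoped MatrixGroups ModularForm Manifold Real

open Literature.NumberTheory.EllipticCurves.ModularForms (intGL intGL_apply)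

/-! ## The Legendre function of the second kind (Heine's integral) -/

/-- `greenQ s t = Q_{s-1}(t) := ∫₀^∞ (t + √(t² - 1) cosh u)^{-s} du`, the Legendre function of the
second kind of degree `s - 1` through Heine's integral, for an integral parameter `s` and `t > 1`
(Bruinier–Li–Yang 2025, (1.1); Gross–Zagier 1986, §II.2). For `t > 1` and `s ≥ 1` the integrand is
positive, continuous and `O(e^{-su})`, so this is a genuine (Bochner = Lebesgue) integral; `Q_{s-1}`
has a logarithmic singularity as `t → 1⁺`. [cite: BruinierLiYang2025, (1.1)] -/
def greenQ (s : ℕ) (t : ℝ) : ℝ :=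
  ∫ u in Set.Ioi (0 : ℝ), ((t + √(t ^ 2 - 1) * Real.cosh u) ^ s)⁻¹

/-- The argument `1 + |z₁ - z₂|² / (2 Im z₁ Im z₂)` of `Q_{s-1}` in (1.1) of Bruinier–Li–Yang 2025
is `cosh` of the hyperbolic distance (Mathlib's `UpperHalfPlane.cosh_dist`). [folklore] -/
theorem one_add_dist_sq_div_eq_cosh_dist (z₁ z₂ : ℍ) :
    1 + dist (z₁ : ℂ) (z₂ : ℂ) ^ 2 / (2 * z₁.im * z₂.im) = Real.cosh (dist z₁ z₂) :=
  (cosh_dist z₁ z₂).symm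

/-! ## `R_N^{(m)}` and the higher Green functions `G_s^{Γ₀(N), m}` -/

/-- `R_N^{(m)} := {γ = (a b; c d) ∈ M₂(ℤ) : N ∣ c, det γ = m}`, the determinant-`m` part of the order
`R_N = {(a b; Nc d)}` of Bruinier–Li–Yang 2025, (1.2); `R_N^{(1)} = Γ₀(N)`
(`coe_mem_heckeMatrices_one_iff`). [cite: BruinierLiYang2025, (1.2)] -/
def heckeMatrices (N : ℕ) (m : ℤ) : Set (Matrix (Fin 2) (Fin 2) ℤ) :=
  {γ | γ.det = m ∧ (N : ℤ) ∣ γ 1 0}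

/-- Membership in `R_N^{(m)}`. [cite: BruinierLiYang2025, (1.2)] -/
theorem mem_heckeMatrices {N : ℕ} {m : ℤ} {γ : Matrix (Fin 2) (Fin 2) ℤ} :
    γ ∈ heckeMatrices N m ↔ γ.det = m ∧ (N : ℤ) ∣ γ 1 0 :=
  Iff.rfl

/-- `R_N^{(1)} = Γ₀(N)`: an element of `SL(2, ℤ)` lies in `R_N^{(1)}` iff it lies in Mathlib's
`CongruenceSubgroup.Gamma0 N`. [folklore] -/
theorem coe_mem_heckeMatrices_one_iff {N : ℕ} (γ : SL(2, ℤ)) :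
    (γ : Matrix (Fin 2) (Fin 2) ℤ) ∈ heckeMatrices N 1 ↔ γ ∈ Gamma0 N := by
  rw [mem_heckeMatrices, Gamma0_mem, ZMod.intCast_zmod_eq_zero_iff_dvd]
  simp [γ.det_coe]

/-- The **higher (automorphic) Green function translated by the `m`-th Hecke correspondence**,
`G_s^{Γ₀(N), m}(z₁, z₂) = -2 Σ_{γ ∈ R_N^{(m)}} Q_{s-1}(1 + |z₁ - γ z₂|² / (2 Im z₁ Im γz₂))`
for an integral parameter `s` (a *higher Green function* when `s ≥ 2`): this is (1.2) of
Bruinier–Li–Yang 2025, `Σ_{γ ∈ Γ₀(N) \ R_N, det γ = m} G_s^{Γ₀(N)}(z₁, γ z₂)`, with the sum (1.1)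
`G_s^{Γ₀(N)}(z₁, z₂) = -2 Σ_{γ ∈ Γ₀(N)} Q_{s-1}(…)` over `Γ₀(N)` unfolded (`Γ₀(N) R_N^{(m)} = R_N^{(m)}`);
`m = 1` is `G_s^{Γ₀(N)}` itself. An integer matrix `γ` of determinant `m ≥ 1` acts on `ℍ` by
`z ↦ (az + b)/(cz + d)` through `intGL γ ∈ GL(2, ℝ)` and Mathlib's action. The series converges
absolutely for `s > 1` and `z₁ ∉ R_N^{(m)} z₂` ((1.1): `Re(s) > 1`); the Lean `tsum` is `0` where it
does not. [cite: BruinierLiYang2025, (1.1)–(1.2)] -/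
def higherGreen (N : ℕ) (s : ℕ) (m : ℤ) (z₁ z₂ : ℍ) : ℝ :=
  -2 * ∑' γ : heckeMatrices N m,
    greenQ s (1 + dist (z₁ : ℂ) ((intGL (γ : Matrix (Fin 2) (Fin 2) ℤ) • z₂ : ℍ) : ℂ) ^ 2 /
      (2 * z₁.im * (intGL (γ : Matrix (Fin 2) (Fin 2) ℤ) • z₂).im))

/-- `(z₁, z₂)` lies on the `m`-th Hecke correspondence `T_m ⊂ X₀(N) × X₀(N)` iff `z₁ = γ z₂` for
some `γ ∈ R_N^{(m)}` (Bruinier–Li–Yang 2025, proof of Corollary 2.4: `Z(m, 0) = T_m`); this is the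
singular locus of `G_s^{Γ₀(N), m}`, and it does not depend on the lifts of `z₁, z₂` to `ℍ` since
`Γ₀(N) R_N^{(m)} Γ₀(N) = R_N^{(m)}`. [cite: BruinierLiYang2025, Cor. 2.4 (proof)] -/
def OnHeckeCorrespondence (N : ℕ) (m : ℤ) (z₁ z₂ : ℍ) : Prop :=
  ∃ γ ∈ heckeMatrices N m, intGL γ • z₂ = z₁

/-! ## Rational weakly holomorphic forms with poles only at `∞`, and `G_{r+1,f}` -/

/-- `f ∈ M^{!,∞}_k(Γ₀(N))` **with rational Fourier coefficients `c` at `∞`**: `f : ℍ → ℂ` is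
holomorphic, `f ∣[k] γ = f` for `γ ∈ Γ₀(N)`, `f(z) = Σ_{m ∈ ℤ, m ≥ -M} c(m) e^{2πimz}` on `ℍ` with
`c(m) ∈ ℚ` and finitely many negative `m` (a pole of finite order at the cusp `∞`), and `f` is
holomorphic at every other cusp: `f ∣[k] γ` is bounded at `i∞` for every `γ ∈ SL(2, ℤ) ∖ Γ₀(N)`
(the cusps `γ∞`, `γ ∉ Γ₀(N)`, are exactly the cusps of `X₀(N)` other than `∞`). This is the space
`M^{!,∞}_k(Γ) := {f ∈ M^!_k(Γ) : f holomorphic away from the cusp ∞}` of Bruinier–Li–Yang 2025,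
(2.6), together with the rationality hypothesis of their Conjecture 1.1. [cite: BruinierLiYang2025, (2.6) and Conj. 1.1] -/
structure IsRatWeaklyHolomorphicForm (N : ℕ) (k : ℤ) (f : ℍ → ℂ) (c : ℤ → ℚ) : Prop where
  /-- `f` is holomorphic on `ℍ`. -/
  mdifferentiable : MDifferentiable 𝓘(ℂ) 𝓘(ℂ) f
  /-- Weight-`k` invariance under `Γ₀(N)`. -/
  slash_eq : ∀ γ : SL(2, ℤ), γ ∈ Gamma0 N → f ∣[k] (γ : GL (Fin 2) ℝ) = f
  /-- The principal part at `∞` is finite: `c(m) = 0` for `m < -M`. -/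
  finite_principalPart : ∃ M : ℕ, ∀ m : ℤ, m < -(M : ℤ) → c m = 0
  /-- `f(z) = Σ_m c(m) qᵐ`, `q = e^{2πiz}`, on all of `ℍ` (Fourier expansion at `∞` with the rational
  coefficients `c`). -/
  hasSum_fourier : ∀ z : ℍ,
    HasSum (fun m : ℤ => (c m : ℂ) * Complex.exp (2 * π * Complex.I * m * (z : ℂ))) (f z)
  /-- `f` is holomorphic (bounded) at every cusp other than `∞`. -/
  isBoundedAtImInfty_slash : ∀ γ : SL(2, ℤ), γ ∉ Gamma0 N →
    IsBoundedAtImInfty (f ∣[k] (γ : GL (Fin 2) ℝ))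

/-- The **rational principal higher Green function** attached to `f = Σ c(m) qᵐ ∈ M^{!,∞}_{-2r}(Γ₀(N))`:
`G^{Γ₀(N)}_{r+1,f}(z₁, z₂) := Σ_{m ≥ 1} c(-m) m^r G^{Γ₀(N), m}_{r+1}(z₁, z₂)` (Bruinier–Li–Yang 2025,
(1.3), a finite sum since `c(-m) = 0` for `m ≫ 0`; the printed weight `m^{k-1}` has `k = r + 1`, the
index of `G_k = G_{r+1}`, matching `r! Σ c(m,μ) m^r Φ_{m,μ}` of (2.12) and Corollary 2.4). Only the
coefficients `c` enter. [cite: BruinierLiYang2025, (1.3)] -/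
def principalHigherGreen (N r : ℕ) (c : ℤ → ℚ) (z₁ z₂ : ℍ) : ℝ :=
  ∑' m : ℕ+, (c (-(m : ℤ)) : ℝ) * (m : ℝ) ^ r * higherGreen N (r + 1) (m : ℤ) z₁ z₂

/-! ## CM points and the conjecture -/

/-- `z ∈ ℍ` is a **CM point of discriminant `d`**: `z` satisfies `a z² + b z + c = 0` with
`a, b, c ∈ ℤ`, `a > 0`, `gcd(a, b, c) = 1`, and `d = b² - 4ac` (then `d < 0`,
`IsCMPointOfDisc.disc_neg`). (Gross–Zagier 1986; Viazovska 2015, §20.1.) [folklore] -/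
def IsCMPointOfDisc (z : ℍ) (d : ℤ) : Prop :=
  ∃ a b c : ℤ, 0 < a ∧ Int.gcd (Int.gcd a b) c = 1 ∧
    (a : ℂ) * (z : ℂ) ^ 2 + b * (z : ℂ) + c = 0 ∧ d = b ^ 2 - 4 * a * c

/-- The discriminant of a CM point is negative: if `a z² + b z + c = 0` with `a > 0` and `Im z > 0`
then `b² - 4ac = -4a² (Im z)² < 0`. [folklore] -/
theorem IsCMPointOfDisc.disc_neg {z : ℍ} {d : ℤ} (h : IsCMPointOfDisc z d) : d < 0 := by
  obtain ⟨a, b, c, ha, -, hz, rfl⟩ := h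
  have hx2 : ((z : ℂ) ^ 2).re = z.re ^ 2 - z.im ^ 2 := by
    rw [sq, mul_re, UpperHalfPlane.coe_re, UpperHalfPlane.coe_im]; ring
  have hy2 : ((z : ℂ) ^ 2).im = 2 * z.re * z.im := by
    rw [sq, mul_im, UpperHalfPlane.coe_re, UpperHalfPlane.coe_im]; ring
  have hre := congrArg Complex.re hz
  have him := congrArg Complex.im hz
  simp only [add_re, mul_re, intCast_re, intCast_im, zero_mul, sub_zero, add_im, mul_im,
    add_zero, zero_re, zero_im, hx2, hy2, UpperHalfPlane.coe_re, UpperHalfPlane.coe_im] at hre him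
  have hy : 0 < z.im := z.im_pos
  -- from the imaginary part: `z.im * (2 a re z + b) = 0`, so `2 a re z + b = 0`
  have h1 : (2 * (a : ℝ) * z.re + b) * z.im = 0 := by nlinarith [him]
  have h2 : 2 * (a : ℝ) * z.re + b = 0 := by
    rcases mul_eq_zero.mp h1 with h | h
    · exact h
    · exact absurd h hy.ne'
  -- then `b² - 4ac = -4 a² (im z)²`
  have h3 : ((b ^ 2 - 4 * a * c : ℤ) : ℝ) = -4 * (a : ℝ) ^ 2 * z.im ^ 2 := by
    push_cast
    linear_combination (-4 * (a : ℝ)) * hre + (2 * (a : ℝ) * z.re + b) * h2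
  have h4 : ((b ^ 2 - 4 * a * c : ℤ) : ℝ) < 0 := by
    rw [h3]
    have : 0 < (a : ℝ) ^ 2 * z.im ^ 2 := by positivity
    linarith
  exact_mod_cast h4

/-- **The Gross–Zagier (Gross–Kohnen–Zagier) algebraicity conjecture for CM values of higher Green
functions — a theorem of Bruinier–Li–Yang.** Bruinier–Li–Yang 2025, Conjecture 1.1: "Suppose
`f ∈ M^{!,∞}_{-2r}(Γ₀(N))` has rational Fourier coefficients at the cusp infinity. Then for any CM
point `(z₁, z₂) ∈ X₀(N)² ∖ Z_f` with `zⱼ` having discriminant `dⱼ < 0`, there exists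
`α = α(z₁, z₂) ∈ ℚ̄ ⊂ ℂ` such that `G^{Γ₀(N)}_{r+1,f}(z₁, z₂) = |d₁d₂|^{-r/2} log|α|`", where
`Z_f = Σ_{m ≥ 1, c(-m) ≠ 0} T_m` and `-2r < 0`; and Theorem 1.4 of the same paper: "In particular
Conjecture 1.1 is true" (for `ℚ(z₁) ≠ ℚ(z₂)` by their Theorem 1.2 and Li, arXiv:2106.13653; for
`ℚ(z₁) = ℚ(z₂)`, i.e. `d₁d₂` a square, by Bruinier–Ehlen–Yang 2021, p. 3 of the paper). Originally
Gross–Zagier 1986, §V.4 (level 1, `d₁ = d₂`) and Gross–Kohnen–Zagier 1987, §V.1. Here: level `N ≥ 1`,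
`r ≥ 1`, `f` with coefficients `c` as in `IsRatWeaklyHolomorphicForm N (-2r) f c`, `(z₁, z₂) ∉ Z_f`
spelled out as `z₁ ≠ γ z₂` for all `γ ∈ R_N^{(m)}` whenever `c(-m) ≠ 0`, and `α ≠ 0` algebraic
over `ℚ`. [cite: BruinierLiYang2025, Conj. 1.1 and Thm. 1.4] -/
def GKZAlgebraicity : Prop :=
  ∀ (N r : ℕ), 0 < N → 0 < r →
  ∀ (f : ℍ → ℂ) (c : ℤ → ℚ), IsRatWeaklyHolomorphicForm N (-2 * (r : ℤ)) f c →
  ∀ (z₁ z₂ : ℍ) (d₁ d₂ : ℤ), IsCMPointOfDisc z₁ d₁ → IsCMPointOfDisc z₂ d₂ →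
    (∀ m : ℕ+, c (-(m : ℤ)) ≠ 0 → ¬ OnHeckeCorrespondence N (m : ℤ) z₁ z₂) →
    ∃ α : ℂ, IsAlgebraic ℚ α ∧ α ≠ 0 ∧
      principalHigherGreen N r c z₁ z₂ =
        |((d₁ * d₂ : ℤ) : ℝ)| ^ (-(r : ℝ) / 2) * Real.log ‖α‖

end Literature.NumberTheory.Automorphic
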